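import Literature.Probability.RandomPlanarGeometry.SpinObservableLocalMartingale
import HarnessLib

/-!
# Driving local martingales from the FK observable WITHOUT moment bounds

Topic `Literature/Probability/RandomPlanarGeometry` (family `crit-ising`); theorems only, no
definition of a named fact. The FK-Ising (`κ = 16/3`) companion of
`SpinObservableLocalMartingale.lean` (spin-Ising, `κ = 3`), which see for the method:
localisation at the far-field stopping time `ρ_L = farStopTime W L` of a FIXED level `L` and
observable levels `y → ∞`, so that the coefficient martingales of the far-field expansion are
EXACT on the stopped processes and no integrability of the driving process is needed.

Duminil-Copin–Smirnov, Clay Math. Proc. 15 (2012), proof of Prop. 6.7 (p. 29) and Chelkak–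
Duminil-Copin–Hongler–Kemppainen–Smirnov, C. R. Math. 352 (2014), §3, extract from the FK
martingale observable `√π M_t^z = √(g_t'(z)/(g_t(z) - W_t)) = z^{-1/2}(1 + W_t/(2z) +
(3W_t² - 16t)/(8z²) + O(z⁻³))` the two driving martingales `W_t` and `W_t² - (16/3) t`,
exchanging expansion and conditional expectation thanks to moment bounds (CDHKS Thm. 3;
Kemppainen–Smirnov 2017, Prop. 3.8). The tree's transcription
`Loewner.martingale_driver_of_fkObservable` (`ObservableDrivingMartingales.lean`) carries an
`L³` running-supremum hypothesis accordingly, and so does the layer-5 named fact (M5′)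
`LatticeModels.exists_cylinderObservableIdentity_fkInterface`. Here, as for the spin case, the
conclusion that the FK identification actually consumes — the layer-3 fact (L″)
`LatticeModels.exists_drivingMartingale_fkInterface` is stated in Lévy's LOCAL format
`IsLocalMartingale ((√(16/3))⁻¹ W) ∧ HasQuadraticVariation ((√(16/3))⁻¹ W) t` — is PROVED from
the martingale property of the time-limited FK observables `N^y = Loewner.observableProcess W y`
at all large levels WITHOUT any moment hypothesis:

* `Loewner.stoppedProcess_observableProcess_level`, `Loewner.norm_stoppedProcess_observableProcess_sub_le`,
  `Loewner.abs_im_stoppedProcess_observableProcess_add_le`,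
  `Loewner.abs_re_stoppedProcess_observableProcess_sub_le` — the far-field expansion
  (`FarRegime.norm_fkObservable_sub_le`, DCS p. 29) at the doubly stopped clock `r ∧ ρ_L` for
  every level `y ≥ L`, remainder `64 ((L/128 + √t)/y)³`;
* `Loewner.martingale_stoppedDriver_of_fkObservable`,
  `Loewner.martingale_stoppedQuad_of_fkObservable` — `W^{ρ_L}` and
  `(W^{ρ_L})² - (16/3)(· ∧ ρ_L)` are martingales (general coefficient lemmas of
  `SpinObservableDrivingMartingales.lean` with `a = 1/2`, `b = 3/8`, `κ = 16/3` and
  `K = 64 L²/y²`, resp. `64 L/y`, then `y → ∞`);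
* `Loewner.isLocalMartingale_driver_of_fkObservable`,
  `Loewner.isLocalMartingale_hasQuadraticVariation_of_fkObservable` — `W`, `W² - (16/3)t` local
  martingales; Lévy's format for `X = (√(16/3))⁻¹ W`.

The passage from the cylinder identity of (M5′) to the martingale hypotheses used here is the
lattice-side `LatticeModels.martingale_re_im_observableProcess_of_cylinder`
(`LatticeModels/FKIsingNaturalMartingale.lean`), not imported here (import direction).

## References

* H. Duminil-Copin, S. Smirnov, *Conformal invariance of lattice models*, Clay Math. Proc. 15
  (2012) 213–276 (arXiv:1109.1549), proof of Prop. 6.7, p. 29.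
* D. Chelkak, H. Duminil-Copin, C. Hongler, A. Kemppainen, S. Smirnov, *Convergence of Ising
  interfaces to Schramm's SLE curves*, C. R. Math. Acad. Sci. Paris 352 (2014) 157–161, §3.
* D. Revuz, M. Yor, *Continuous Martingales and Brownian Motion* (1999), Ch. IV, Def. (1.5),
  Thm. (3.6).
-/

noncomputable section

open Set Filter Topology Metric MeasureTheory Complex ProbabilityTheory
open scoped NNReal

namespace Literature.Probability.RandomPlanarGeometry

namespace Loewner

open Literature.Probability.Process

variable {Ω : Type*} {m : MeasurableSpace Ω} {W : ℝ≥0 → Ω → ℝ}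

/-! ### The far-field expansion of the FK observable at the doubly stopped clock -/

section Expansion

/-- **The time-limited FK observable at the clock `r ∧ ρ_L` is the FK observable there**
(`y ≥ L > 0`: the clock is below the time horizon `y²/9`). [folklore] -/
theorem stoppedProcess_observableProcess_level (hWc : ∀ ω, Continuous (W · ω)) {L y : ℝ}
    (hL : 0 < L) (hLy : L ≤ y) (r : ℝ≥0) (ω : Ω) :
    stoppedProcess (observableProcess W y) (farStopTime W L) r ω =
      fkObservable (fun u ↦ W u ω) (min (r : WithTop ℝ≥0) (farStopTime W L ω)).untopA (I * y) := by
  simp only [stoppedProcess, observableProcess_apply]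
  rw [min_eq_left (untopA_min_farStopTime_le_cdhksTime hWc hL hLy r ω)]

/-- **Pathwise expansion of the FK observable at the clock `r ∧ ρ_L`, level `y ≥ L`**: with
`A = W_{r∧ρ_L}`, `σ = r ∧ ρ_L` and `r ≤ t`,
`‖N^y_{r∧ρ_L} - (1 + A/(2iy) + (3A² - 16σ)/(8(iy)²))‖ ≤ 64 ((L/128 + √t)/y)³`.
[cite: DuminilCopinSmirnov2012Clay, Prop. 6.7 (proof, p. 29)] -/
theorem norm_stoppedProcess_observableProcess_sub_le (hWc : ∀ ω, Continuous (W · ω))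
    (hW0 : ∀ ω, W 0 ω = 0) {L y : ℝ} (hL : 0 < L) (hLy : L ≤ y) {r t : ℝ≥0} (hr : r ≤ t)
    (ω : Ω) :
    ‖stoppedProcess (observableProcess W y) (farStopTime W L) r ω -
        (1 + ((stoppedProcess W (farStopTime W L) r ω : ℝ) : ℂ) / (2 * (I * y)) +
          (3 * ((stoppedProcess W (farStopTime W L) r ω : ℝ) : ℂ) ^ 2 -
              16 * (((min (r : WithTop ℝ≥0) (farStopTime W L ω)).untopA : ℝ) : ℂ)) /
            (8 * (I * y) ^ 2))‖ ≤
      64 * ((L / 128 + Real.sqrt t) / y) ^ 3 := by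
  have hreg := farRegime_stopped_level hWc hW0 hL hLy r ω
  have hy : 0 < y := hL.trans_le hLy
  set σ := (min (r : WithTop ℝ≥0) (farStopTime W L ω)).untopA with hσ
  have hσt : σ ≤ t := (untopA_min_coe_le r _).trans hr
  have hmain := hreg.norm_fkObservable_sub_le
  have hnorm : ‖I * (y : ℂ)‖ = y := by simp [abs_of_pos hy]
  rw [hnorm] at hmain
  rw [stoppedProcess_observableProcess_level hWc hL hLy r ω]
  refine (le_of_eq ?_).trans (hmain.trans ?_)
  · rfl
  · have hK : L / 128 + Real.sqrt σ ≤ L / 128 + Real.sqrt t := by gcongr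
    have hK0 : 0 ≤ L / 128 + Real.sqrt σ := add_nonneg (by positivity) (Real.sqrt_nonneg _)
    gcongr

/-- **Imaginary part at the doubly stopped clock: `|Im N + A/(2y)| ≤ 64 ((L/128 + √t)/y)³`.**
[folklore] -/
theorem abs_im_stoppedProcess_observableProcess_add_le (hWc : ∀ ω, Continuous (W · ω))
    (hW0 : ∀ ω, W 0 ω = 0) {L y : ℝ} (hL : 0 < L) (hLy : L ≤ y) {r t : ℝ≥0} (hr : r ≤ t)
    (ω : Ω) :
    |(stoppedProcess (observableProcess W y) (farStopTime W L) r ω).im +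
        stoppedProcess W (farStopTime W L) r ω / (2 * y)| ≤
      64 * ((L / 128 + Real.sqrt t) / y) ^ 3 := by
  have hy : 0 < y := hL.trans_le hLy
  have h := norm_stoppedProcess_observableProcess_sub_le hWc hW0 hL hLy hr ω
  rw [main_term_eq hy.ne'] at h
  set a : ℝ := 1 - (3 * stoppedProcess W (farStopTime W L) r ω ^ 2 -
      16 * ((min (r : WithTop ℝ≥0) (farStopTime W L ω)).untopA : ℝ)) / (8 * y ^ 2) with ha
  set b : ℝ := -stoppedProcess W (farStopTime W L) r ω / (2 * y) with hb
  set O := stoppedProcess (observableProcess W y) (farStopTime W L) r ω with hO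
  have him : (O - ((a : ℂ) + (b : ℂ) * I)).im =
      O.im + stoppedProcess W (farStopTime W L) r ω / (2 * y) := by
    simp only [sub_im, add_im, ofReal_im, mul_im, ofReal_re, I_re, I_im, mul_zero, mul_one, zero_add,
      add_zero, hb]
    ring
  rw [← him]
  exact (abs_im_le_norm _).trans h

/-- **Real part at the doubly stopped clock:
`|Re N - 1 + (3A² - 16σ)/(8y²)| ≤ 64 ((L/128 + √t)/y)³`.** [folklore] -/
theorem abs_re_stoppedProcess_observableProcess_sub_le (hWc : ∀ ω, Continuous (W · ω))
    (hW0 : ∀ ω, W 0 ω = 0) {L y : ℝ} (hL : 0 < L) (hLy : L ≤ y) {r t : ℝ≥0} (hr : r ≤ t)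
    (ω : Ω) :
    |(stoppedProcess (observableProcess W y) (farStopTime W L) r ω).re - 1 +
        (3 * stoppedProcess W (farStopTime W L) r ω ^ 2 -
          16 * ((min (r : WithTop ℝ≥0) (farStopTime W L ω)).untopA : ℝ)) / (8 * y ^ 2)| ≤
      64 * ((L / 128 + Real.sqrt t) / y) ^ 3 := by
  have hy : 0 < y := hL.trans_le hLy
  have h := norm_stoppedProcess_observableProcess_sub_le hWc hW0 hL hLy hr ω
  rw [main_term_eq hy.ne'] at h
  set a : ℝ := 1 - (3 * stoppedProcess W (farStopTime W L) r ω ^ 2 -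
      16 * ((min (r : WithTop ℝ≥0) (farStopTime W L ω)).untopA : ℝ)) / (8 * y ^ 2) with ha
  set b : ℝ := -stoppedProcess W (farStopTime W L) r ω / (2 * y) with hb
  set O := stoppedProcess (observableProcess W y) (farStopTime W L) r ω with hO
  have hre : (O - ((a : ℂ) + (b : ℂ) * I)).re = O.re - 1 +
      (3 * stoppedProcess W (farStopTime W L) r ω ^ 2 -
        16 * ((min (r : WithTop ℝ≥0) (farStopTime W L ω)).untopA : ℝ)) / (8 * y ^ 2) := by
    simp only [sub_re, add_re, ofReal_re, mul_re, ofReal_im, I_re, I_im, mul_zero, mul_one, sub_zero,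
      ha]
    ring
  rw [← hre]
  exact (abs_re_le_norm _).trans h

end Expansion

/-! ### The two stopped martingales at a fixed level -/

section Stopped

variable {𝓕 : Filtration ℝ≥0 m} {P : Measure Ω} [IsProbabilityMeasure P]

/-- **Order one, localised (FK): the driver stopped at `ρ_L` is a martingale**, if the imaginary
parts of the time-limited FK observables `N^y` are `𝓕`-martingales for all `y ≥ y₀` (`W`
strongly adapted, continuous paths, `W_0 = 0`; no moment hypothesis): the general coefficient
lemma with `a = 1/2`, the rescaled martingale `(y/L) Im N^y_{·∧ρ_L}` and `K = 64 L²/y²` gives an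
`L¹` defect `≤ 256 (L/128 + √t)³/y² → 0`.
[cite: DuminilCopinSmirnov2012Clay, Prop. 6.7 (proof, p. 29)] -/
theorem martingale_stoppedDriver_of_fkObservable (hWad : StronglyAdapted 𝓕 W)
    (hWc : ∀ ω, Continuous (W · ω)) (hW0 : ∀ ω, W 0 ω = 0) {L : ℝ} (hL : 0 < L) {y₀ : ℝ}
    (him : ∀ y, y₀ ≤ y → Martingale (fun r ω ↦ (observableProcess W y r ω).im) 𝓕 P) :
    Martingale (stoppedProcess W (farStopTime W L)) 𝓕 P := by
  set ρ := farStopTime W L with hρ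
  set V := stoppedProcess W ρ with hV
  have hVad : StronglyAdapted 𝓕 V := stronglyAdapted_stoppedProcess_farStopTime hWad hWc L
  have hVc : ∀ ω, Continuous (V · ω) := continuous_stoppedProcess_farStopTime hWc L
  have hVbd : ∀ r ω, |V r ω| ≤ L / 128 := abs_stoppedProcess_farStopTime_le hWc hW0 hL
  have hVint : ∀ r, Integrable (V r) P :=
    integrable_stoppedProcess_farStopTime hWad hWc hW0 hL
  have hVV : stoppedProcess V (farStopTime V L) = V :=
    funext fun r ↦ funext fun ω ↦ stoppedProcess_stoppedProcess_farStopTime hWc L r ω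
  set X : ℝ≥0 → ℝ := fun t ↦ (L / 128 + Real.sqrt t) ^ 3 with hX
  have key : ∀ s t : ℝ≥0, s ≤ t → ∀ y, max y₀ L ≤ y →
      ∫ ω, |(P[V t | 𝓕 s]) ω - V s ω| ∂P ≤ 256 * X t / y ^ 2 := by
    intro s t hst y hy
    have hLy : L ≤ y := (le_max_right _ _).trans hy
    have hy0y : y₀ ≤ y := (le_max_left _ _).trans hy
    have hy : 0 < y := hL.trans_le hLy
    have hN : Martingale (stoppedProcess (fun r ω ↦ (observableProcess W y r ω).im) ρ) 𝓕 P :=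
      martingale_stoppedProcess_farStopTime hWad hWc L (him y hy0y)
        fun ω ↦ continuous_im.comp (continuous_observableProcess hWc hy ω)
    set Oim : ℝ≥0 → Ω → ℝ :=
      (y / L) • stoppedProcess (fun r ω ↦ (observableProcess W y r ω).im) ρ with hOim
    have hOm : Martingale Oim 𝓕 P := hN.smul _
    have hM : MemLp (fun _ : Ω ↦ L / 128) 3 P := memLp_const _
    have hbd : ∀ᵐ ω ∂P, ∀ u, u ≤ t → |V u ω| ≤ L / 128 := ae_of_all _ fun ω u _ ↦ hVbd u ω
    have hcoef : ∀ᵐ ω ∂P, ∀ r, r ≤ t →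
        |Oim r ω + 1 / 2 * stoppedProcess V (farStopTime V L) r ω / L| ≤
          64 * L ^ 2 / y ^ 2 * ((L / 128 + Real.sqrt t) / L) ^ 3 := by
      refine ae_of_all _ fun ω r hr ↦ ?_
      have h1 := abs_im_stoppedProcess_observableProcess_add_le hWc hW0 hL hLy hr ω
      rw [stoppedProcess_stoppedProcess_farStopTime hWc L r ω]
      have heq : Oim r ω + 1 / 2 * stoppedProcess W (farStopTime W L) r ω / L =
          (y / L) * ((stoppedProcess (observableProcess W y) (farStopTime W L) r ω).im +
            stoppedProcess W (farStopTime W L) r ω / (2 * y)) := by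
        simp only [hOim, Pi.smul_apply, smul_eq_mul, stoppedProcess, hρ]
        field_simp
      rw [heq, abs_mul, abs_of_pos (div_pos hy hL)]
      calc y / L * |(stoppedProcess (observableProcess W y) (farStopTime W L) r ω).im +
              stoppedProcess W (farStopTime W L) r ω / (2 * y)|
          ≤ y / L * (64 * ((L / 128 + Real.sqrt t) / y) ^ 3) := by gcongr
        _ = 64 * L ^ 2 / y ^ 2 * ((L / 128 + Real.sqrt t) / L) ^ 3 := by
          field_simp
    have h := integral_abs_condExp_stoppedDriver_sub_le_of_coeff hVad hVc hL
      (by norm_num : (1 / 2 : ℝ) ≠ 0) hOm hst hM (fun _ ↦ by positivity) hbd hcoef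
    rw [hVV] at h
    refine h.trans (le_of_eq ?_)
    rw [integral_const, smul_eq_mul, abs_of_pos (by norm_num : (0 : ℝ) < 1 / 2)]
    simp only [probReal_univ, one_mul, hX]
    field_simp
    norm_num
  refine ⟨hVad, fun s t hst ↦ ?_⟩
  refine condExp_ae_eq_of_approx (hVint t) (hVint s) fun ε hε ↦
    ⟨V t, V s, hVint t, hVint s, by simp [hε.le], by simp [hε.le], ?_⟩
  have hc := tendsto_const_div_pow_atTop_nhds_zero (256 * X t) two_ne_zero
  obtain ⟨y, hy1, hy2⟩ := ((eventually_ge_atTop (max y₀ L)).and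
    (hc.eventually (Iic_mem_nhds hε))).exists
  exact (key s t hst y hy1).trans hy2

/-- **Order two, localised (FK): `(W^{ρ_L})² - (16/3)(· ∧ ρ_L)` is a martingale**, if the real
parts of `N^y` are martingales for all `y ≥ y₀`: the general coefficient lemma with `b = 3/8`,
`κ = 16/3`, the rescaled martingale `1 + (y/L)² (Re N^y_{·∧ρ_L} - 1)` and `K = 64 L/y` gives an
`L¹` defect `≤ (1024/3) (L/128 + √t)³/y → 0`. No moment hypothesis.
[cite: DuminilCopinSmirnov2012Clay, Prop. 6.7 (proof, p. 29)] -/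
theorem martingale_stoppedQuad_of_fkObservable (hWad : StronglyAdapted 𝓕 W)
    (hWc : ∀ ω, Continuous (W · ω)) (hW0 : ∀ ω, W 0 ω = 0) {L : ℝ} (hL : 0 < L) {y₀ : ℝ}
    (hre : ∀ y, y₀ ≤ y → Martingale (fun r ω ↦ (observableProcess W y r ω).re) 𝓕 P) :
    Martingale (fun r ω ↦ stoppedProcess W (farStopTime W L) r ω ^ 2 -
      16 / 3 * (((min (r : WithTop ℝ≥0) (farStopTime W L ω)).untopA : ℝ≥0) : ℝ)) 𝓕 P := by
  set ρ := farStopTime W L with hρ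
  set V := stoppedProcess W ρ with hV
  have hVad : StronglyAdapted 𝓕 V := stronglyAdapted_stoppedProcess_farStopTime hWad hWc L
  have hVc : ∀ ω, Continuous (V · ω) := continuous_stoppedProcess_farStopTime hWc L
  have hVbd : ∀ r ω, |V r ω| ≤ L / 128 := abs_stoppedProcess_farStopTime_le hWc hW0 hL
  have hVV : stoppedProcess V (farStopTime V L) = V :=
    funext fun r ↦ funext fun ω ↦ stoppedProcess_stoppedProcess_farStopTime hWc L r ω
  have hρρ : farStopTime V L = ρ := funext fun ω ↦ farStopTime_stoppedProcess_self hWc L ω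
  set Q : ℝ≥0 → Ω → ℝ := fun r ω ↦ V r ω ^ 2 -
    16 / 3 * (((min (r : WithTop ℝ≥0) (ρ ω)).untopA : ℝ≥0) : ℝ) with hQ
  have hQad : StronglyAdapted 𝓕 Q := fun r ↦
    ((hVad r).pow 2).sub ((stronglyAdapted_stoppedClock_farStopTime hWad hWc L r).const_mul _)
  have hM : MemLp (fun _ : Ω ↦ L / 128) 3 P := memLp_const _
  have hM2 : Integrable (fun _ : Ω ↦ (L / 128) ^ 2) P := integrable_const _
  have hQint : ∀ r, Integrable (Q r) P := by
    intro r
    have hbd : ∀ᵐ ω ∂P, ∀ u, u ≤ r → |V u ω| ≤ L / 128 := ae_of_all _ fun ω u _ ↦ hVbd u ω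
    have := integrable_stoppedQuad' hVad hVc hM2 hbd le_rfl L (16 / 3)
    rwa [hVV, hρρ] at this
  set X : ℝ≥0 → ℝ := fun t ↦ (L / 128 + Real.sqrt t) ^ 3 with hX
  have key : ∀ s t : ℝ≥0, s ≤ t → ∀ y, max y₀ L ≤ y →
      ∫ ω, |(P[Q t | 𝓕 s]) ω - Q s ω| ∂P ≤ 1024 / 3 * X t / y := by
    intro s t hst y hy
    have hLy : L ≤ y := (le_max_right _ _).trans hy
    have hy0y : y₀ ≤ y := (le_max_left _ _).trans hy
    have hy : 0 < y := hL.trans_le hLy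
    have hN : Martingale (stoppedProcess (fun r ω ↦ (observableProcess W y r ω).re) ρ) 𝓕 P :=
      martingale_stoppedProcess_farStopTime hWad hWc L (hre y hy0y)
        fun ω ↦ continuous_re.comp (continuous_observableProcess hWc hy ω)
    set Ore : ℝ≥0 → Ω → ℝ := (fun _ _ ↦ (1 : ℝ)) +
      (y ^ 2 / L ^ 2) • (stoppedProcess (fun r ω ↦ (observableProcess W y r ω).re) ρ -
        fun _ _ ↦ (1 : ℝ)) with hOre
    have hOm : Martingale Ore 𝓕 P :=
      (martingale_const 𝓕 P (1 : ℝ)).add ((hN.sub (martingale_const 𝓕 P (1 : ℝ))).smul _)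
    have hbd : ∀ᵐ ω ∂P, ∀ u, u ≤ t → |V u ω| ≤ L / 128 := ae_of_all _ fun ω u _ ↦ hVbd u ω
    have hcoef : ∀ᵐ ω ∂P, ∀ r, r ≤ t →
        |Ore r ω - 1 + 3 / 8 * (stoppedProcess V (farStopTime V L) r ω ^ 2 -
          16 / 3 * (((min (r : WithTop ℝ≥0) (farStopTime V L ω)).untopA : ℝ≥0) : ℝ)) / L ^ 2| ≤
          64 * L / y * ((L / 128 + Real.sqrt t) / L) ^ 3 := by
      refine ae_of_all _ fun ω r hr ↦ ?_
      have h1 := abs_re_stoppedProcess_observableProcess_sub_le hWc hW0 hL hLy hr ω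
      rw [stoppedProcess_stoppedProcess_farStopTime hWc L r ω, farStopTime_stoppedProcess_self hWc L ω]
      have heq : Ore r ω - 1 + 3 / 8 * (stoppedProcess W (farStopTime W L) r ω ^ 2 -
            16 / 3 * (((min (r : WithTop ℝ≥0) (farStopTime W L ω)).untopA : ℝ≥0) : ℝ)) / L ^ 2 =
          (y ^ 2 / L ^ 2) * ((stoppedProcess (observableProcess W y) (farStopTime W L) r ω).re - 1 +
            (3 * stoppedProcess W (farStopTime W L) r ω ^ 2 -
              16 * (((min (r : WithTop ℝ≥0) (farStopTime W L ω)).untopA : ℝ≥0) : ℝ)) /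
              (8 * y ^ 2)) := by
        simp only [hOre, Pi.add_apply, Pi.smul_apply, Pi.sub_apply, smul_eq_mul, stoppedProcess, hρ]
        field_simp
        ring
      rw [heq, abs_mul, abs_of_pos (by positivity : (0 : ℝ) < y ^ 2 / L ^ 2)]
      calc y ^ 2 / L ^ 2 * |(stoppedProcess (observableProcess W y) (farStopTime W L) r ω).re - 1 +
              (3 * stoppedProcess W (farStopTime W L) r ω ^ 2 -
                16 * (((min (r : WithTop ℝ≥0) (farStopTime W L ω)).untopA : ℝ≥0) : ℝ)) /
                (8 * y ^ 2)|
          ≤ y ^ 2 / L ^ 2 * (64 * ((L / 128 + Real.sqrt t) / y) ^ 3) := by gcongr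
        _ = 64 * L / y * ((L / 128 + Real.sqrt t) / L) ^ 3 := by
          field_simp
    have h := integral_abs_condExp_stoppedQuad_sub_le_of_coeff hVad hVc (κ := 16 / 3) hL
      (by norm_num : (3 / 8 : ℝ) ≠ 0) hOm hst hM (fun _ ↦ by positivity) hbd hcoef
    rw [hVV, hρρ] at h
    refine h.trans (le_of_eq ?_)
    rw [integral_const, smul_eq_mul, abs_of_pos (by norm_num : (0 : ℝ) < 3 / 8)]
    simp only [probReal_univ, one_mul, hX]
    field_simp
    norm_num
  refine ⟨hQad, fun s t hst ↦ ?_⟩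
  refine condExp_ae_eq_of_approx (hQint t) (hQint s) fun ε hε ↦
    ⟨Q t, Q s, hQint t, hQint s, by simp [hε.le], by simp [hε.le], ?_⟩
  have hc := tendsto_const_div_pow_atTop_nhds_zero (1024 / 3 * X t) one_ne_zero
  simp only [pow_one] at hc
  obtain ⟨y, hy1, hy2⟩ := ((eventually_ge_atTop (max y₀ L)).and
    (hc.eventually (Iic_mem_nhds hε))).exists
  exact (key s t hst y hy1).trans hy2

end Stopped

/-! ### Local martingales and Lévy's format (FK, `κ = 16/3`) -/

section Local

variable {𝓕 : Filtration ℝ≥0 m} {P : Measure Ω} [IsProbabilityMeasure P]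

/-- **The driver and `W² - (16/3) t` are local martingales** (localising sequence `ρ_{n+1}`), from
the martingale property of the time-limited FK observables at all large levels; no moment
hypothesis. [cite: DuminilCopinSmirnov2012Clay, Prop. 6.7 (proof, p. 29)] -/
theorem isLocalMartingale_driver_of_fkObservable (hWad : StronglyAdapted 𝓕 W)
    (hWc : ∀ ω, Continuous (W · ω)) (hW0 : ∀ ω, W 0 ω = 0) {y₀ : ℝ}
    (hre : ∀ y, y₀ ≤ y → Martingale (fun r ω ↦ (observableProcess W y r ω).re) 𝓕 P)
    (him : ∀ y, y₀ ≤ y → Martingale (fun r ω ↦ (observableProcess W y r ω).im) 𝓕 P) :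
    IsLocalMartingale W 𝓕 P ∧
      IsLocalMartingale (fun t ω ↦ W t ω ^ 2 - 16 / 3 * (t : ℝ)) 𝓕 P := by
  have hloc := isLocalizingSequence_farStopTime hWad hWc (P := P)
  have hLn : ∀ n : ℕ, (0 : ℝ) < n + 1 := fun n ↦ by positivity
  constructor
  · unfold IsLocalMartingale
    refine ⟨_, hloc, fun n ↦ ?_⟩
    rw [indicator_bot_lt_farStopTime hWc hW0 (hLn n)]
    exact martingale_stoppedDriver_of_fkObservable hWad hWc hW0 (hLn n) him
  · unfold IsLocalMartingale
    refine ⟨_, hloc, fun n ↦ ?_⟩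
    rw [indicator_bot_lt_farStopTime hWc hW0 (hLn n)]
    have h := martingale_stoppedQuad_of_fkObservable hWad hWc hW0 (hLn n) hre
    have heq : stoppedProcess (fun t ω ↦ W t ω ^ 2 - 16 / 3 * (t : ℝ)) (farStopTime W ((n : ℝ) + 1)) =
        fun r ω ↦ stoppedProcess W (farStopTime W ((n : ℝ) + 1)) r ω ^ 2 -
          16 / 3 * (((min (r : WithTop ℝ≥0) (farStopTime W ((n : ℝ) + 1) ω)).untopA : ℝ≥0) : ℝ) := by
      funext r ω
      simp only [stoppedProcess]
    rw [heq]
    exact h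

/-- **Lévy's format (FK): `X = (√(16/3))⁻¹ W` is a continuous local martingale with `⟨X⟩_t = t`**,
from the martingale property of the time-limited FK observables at all large levels; no moment
hypothesis (the local form in which the layer-3 fact (L″)
`LatticeModels.exists_drivingMartingale_fkInterface` is stated).
[cite: DuminilCopinSmirnov2012Clay, Prop. 6.7 (proof, p. 29)] -/
theorem isLocalMartingale_hasQuadraticVariation_of_fkObservable (hWad : StronglyAdapted 𝓕 W)
    (hWc : ∀ ω, Continuous (W · ω)) (hW0 : ∀ ω, W 0 ω = 0) {y₀ : ℝ}
    (hre : ∀ y, y₀ ≤ y → Martingale (fun r ω ↦ (observableProcess W y r ω).re) 𝓕 P)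
    (him : ∀ y, y₀ ≤ y → Martingale (fun r ω ↦ (observableProcess W y r ω).im) 𝓕 P) :
    IsLocalMartingale (fun t ω ↦ (Real.sqrt (16 / 3))⁻¹ * W t ω) 𝓕 P ∧
      HasQuadraticVariation (fun t ω ↦ (Real.sqrt (16 / 3))⁻¹ * W t ω) (fun t _ ↦ (t : ℝ)) 𝓕 P := by
  have hloc := isLocalizingSequence_farStopTime hWad hWc (P := P)
  have hLn : ∀ n : ℕ, (0 : ℝ) < n + 1 := fun n ↦ by positivity
  have hsq : (Real.sqrt (16 / 3))⁻¹ ^ 2 = (3 / 16 : ℝ) := by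
    rw [inv_pow, Real.sq_sqrt (by norm_num : (0 : ℝ) ≤ 16 / 3)]
    norm_num
  have h1 : IsLocalMartingale (fun t ω ↦ (Real.sqrt (16 / 3))⁻¹ * W t ω) 𝓕 P := by
    unfold IsLocalMartingale
    refine ⟨_, hloc, fun n ↦ ?_⟩
    rw [indicator_bot_lt_farStopTime hWc hW0 (hLn n)]
    have h := (martingale_stoppedDriver_of_fkObservable hWad hWc hW0 (hLn n) him).smul
      (Real.sqrt (16 / 3))⁻¹
    have heq : stoppedProcess (fun t ω ↦ (Real.sqrt (16 / 3))⁻¹ * W t ω)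
          (farStopTime W ((n : ℝ) + 1)) =
        (Real.sqrt (16 / 3))⁻¹ • stoppedProcess W (farStopTime W ((n : ℝ) + 1)) := by
      funext r ω
      simp only [stoppedProcess, Pi.smul_apply, smul_eq_mul]
    rw [heq]
    exact h
  have h2 : IsLocalMartingale (fun t ω ↦ ((Real.sqrt (16 / 3))⁻¹ * W t ω) ^ 2 - (t : ℝ)) 𝓕 P := by
    unfold IsLocalMartingale
    refine ⟨_, hloc, fun n ↦ ?_⟩
    rw [indicator_bot_lt_farStopTime hWc hW0 (hLn n)]
    have h := (martingale_stoppedQuad_of_fkObservable hWad hWc hW0 (hLn n) hre).smul (3 / 16 : ℝ)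
    have heq : stoppedProcess (fun t ω ↦ ((Real.sqrt (16 / 3))⁻¹ * W t ω) ^ 2 - (t : ℝ))
          (farStopTime W ((n : ℝ) + 1)) =
        (3 / 16 : ℝ) • fun r ω ↦ stoppedProcess W (farStopTime W ((n : ℝ) + 1)) r ω ^ 2 -
          16 / 3 * (((min (r : WithTop ℝ≥0) (farStopTime W ((n : ℝ) + 1) ω)).untopA : ℝ≥0) : ℝ) := by
      funext r ω
      simp only [stoppedProcess, Pi.smul_apply, smul_eq_mul]
      rw [mul_pow, hsq]
      ring
    rw [heq]
    exact h
  exact ⟨h1,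
    { adapted := fun _ ↦ measurable_const
      continuous := ae_of_all _ fun _ ↦ NNReal.continuous_coe
      monotone := ae_of_all _ fun _ _ _ h ↦ NNReal.coe_le_coe.2 h
      zero := fun _ ↦ NNReal.coe_zero
      isLocalMartingale := h2 }⟩

end Local

end Loewner

end Literature.Probability.RandomPlanarGeometry
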